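import Mathlib.Analysis.Complex.Basic
import Mathlib.LinearAlgebra.Dual.Defs
import Mathlib.Algebra.Group.End                 -- `MulAut.conj`
import Mathlib.Algebra.Group.Subgroup.Map
import Mathlib.GroupTheory.Coset.Basic           -- `QuotientGroup.rightRel` (right cosets `M₀ x`)
import HarnessLib

/-!
# Shelstad, *Characters and inner forms of a quasi-split group over ℝ* (1979), §5 «Stable tempered distributions»
# (LEMMAS 5.1–5.3) and §6 «Correspondences» (PROPOSITION 6.1, LEMMA 6.2, THEOREM 6.3, PROPOSITIONS 6.4–6.6, COROLLARY 6.7)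

Topic `NumberTheory/Automorphic/Shelstad1979`; namespace `Literature.NumberTheory.Automorphic.Shelstad1979.Correspondences`.
STATEMENTS ONLY (a typing carpet): `structure`s and `def`s with bodies, **no theorem, no proof, no `sorry`, no `axiom`, no `instance`,
no `notation`**.  Source: D. Shelstad, Compositio Math. **39** (1979) 11–45 [Shelstad1979], held as the
NUMDAM scan `paper:url-551fef475f69` (36 files, file `pNNNN` = printed page `NNNN + 9`); every page pin below is a PRINTED page.

READING NOTE (for the cite desk).  The NUMDAM text layer of this scan drops every displayed formula.  The displays quoted below
(Lemma 5.1, Lemma 6.2, Theorem 6.3, Propositions 6.4–6.6, Corollary 6.7, Theorem 4.1, the p. 19 identity, the definitions of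
`𝒜(T)`, `Φ¹_f`, `𝔚`, `ζ`) were READ OFF THE PAGE IMAGES of the same PDF (its CCITT-G4 page strips, rendered; printed pp. 13, 16,
19–21 and 38–44 = files p0004, p0007, p0010–p0012, p0029–p0035), not reconstructed from the prose.

## The setting (pp. 12–13, 16, 20–21) and the dress

`G` is (the group of real points of) a connected reductive linear algebraic group over `ℝ`, an inner form of the quasi-split
group `G′`, with a fixed isomorphism `ψ : 𝐆 → 𝐆′` for which `ψ̄ψ⁻¹` is inner (p. 13).  `ψ` is NOT a map on real points; what it
induces on real points is (i) the relation «`γ′ ∈ G′` ORIGINATES FROM `γ ∈ G_reg`»: «if there exists `x ∈ 𝐆′` such that `ψ_x(γ) = γ′`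
and `ψ_x : 𝐓_γ → 𝐓_{γ′}` is defined over `ℝ`», `ψ_x = ad x ∘ ψ` (p. 16); (ii) the correspondence `(f, f′)` of Schwartz functions of
THEOREM 4.1 (p. 21): «Let `f` be a Schwartz function on `G`. Then there is a Schwartz function `f′` on `G′` such that, for
`γ′ ∈ G′_reg`, `Φ¹_{f′}(γ′, dt′, dg′) = (−1)^{q_G − q_{G′}} Φ¹_f(γ, dt, dg)` if `γ′` originates from `γ` in `G`, `= 0` if `γ′` does not
originate in `G`», where `Φ¹_f(γ, dt, dg) = Σ_{ω ∈ 𝒟(T)} Φ_f(γ^ω, (dt)^ω, dg)` is the STABLE ORBITAL INTEGRAL (p. 20; `𝒟(T) = G\𝒜(𝐓)/𝐓`,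
`𝒜(𝐓) = {g ∈ 𝐆 : ad g|𝐓 is defined over ℝ} = {g ∈ 𝐆 : g T g⁻¹ ⊂ G}`, p. 13), the measures `dg′, dt′` being arbitrary and `dg, dt`
transported along `ψ` (p. 20); (iii) the map `φ ↦ φ′` of (tempered) parameters, `Φ(G) ↪ Φ(G′)` (p. 17), and the isomorphism
`λ′ ↦ λ` of infinitesimal characters dual to `z ↦ z′ : 𝔷 → 𝔷′` (p. 41); (iv) the numbers `q_G`: «`2q_G` is the dimension of the
symmetric space attached to the simply-connected covering of the derived group of `G`. Note that `q_{G′} − q_G` is an integer»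
(pp. 19–20).

Mathlib has no real reductive groups, Cartan subgroups, Harish-Chandra Schwartz space `𝒞(G)`, `𝔷`-finite distributions or
tempered characters; §§2–4 of the paper (the carriers `𝒜(T)`, `𝒟(T)`, «originates», `Φ¹_f`, Theorems 4.1∕4.7) belong to the
companion files `…/Shelstad1979/InnerFormsAndCharacters.lean` (§§2–3) and `…/Shelstad1979/StableOrbitalIntegrals.lean` (§4), in
preparation and not yet in the tree.  THIS FILE therefore takes the §§2–4 objects as the fields of two explicit DICTIONARIES — `TemperedSetting G` (one group:
`G_reg`, `𝒞(G)` as a `ℂ`-subspace of `G → ℂ`, the tempered dual as a subspace of the algebraic dual `Module.Dual ℂ 𝒞(G)`, the stable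
orbital integrals `γ ↦ (f ↦ Φ¹_f(γ))`, the `𝒜(T_γ)`-orbit relation `γ ~ γ^ω`, `𝔷`-finiteness, eigendistributions and their infinitesimal
characters, Harish-Chandra's function `F_Θ` on `G_reg` representing an invariant `𝔷`-finite `Θ` [6], the tempered parameters `φ` with
their distributions `χ_φ` (§3 p. 18), and `2q_G ∈ ℕ`) and `InnerFormSetting G G′` (two such, plus «originates», `φ ↦ φ′`, `λ′ ↦ λ`) —
and DEFINES from them, exactly as printed: invariance (`IsInvariantDist`), STABILITY («lies in the closed linear subspace generated by
the distributions `f ↦ Φ¹_f(γ)`, `γ ∈ G_reg`», dual of `𝒞(G)` «equipped with the topology of simple (pointwise) convergence», p. 38 —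
`IsStableDist`, via Mathlib's product topology on `𝒞(G) → ℂ` and `Submodule.span`), the correspondence `(f, f′)` of Theorem 4.1
(`IsTransferPair`) and «`Θ` is the image of `Θ′`» (`IsDualImage`).  The three «observations» PROPOSITIONS 6.4–6.6 inside the proof of
Theorem 6.3 need the Levi data `T ⊆ M₀`, `𝔚 = M₀\{x ∈ G : xTx⁻¹ ⊆ M₀}`, `ζ(γ) = |det(Ad γ − 1)_{𝔤/𝔪₀}|`, `q_{M₀}` (p. 40) on both
sides: the dictionary `LeviDescentDatum D`, with `𝔚` BUILT as a subset of Mathlib's right-coset space `Quotient (QuotientGroup.rightRel M₀)`.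
No field of any dictionary asserts a proposition.  **Every numbered item is a `def … : Prop` PREDICATE on an explicit dictionary**
(precedents ★ `LabesseLanglands1979.Sec6.MultiplicityTable`, ★ `ArthurClozel1989.Ch1Sec7`): print's theorem = the predicate HOLDS for
print's data; a consumer takes `(h : Shelstad1979_6_3_characterIdentity D)` for ITS instantiation `D`; `∀ D, …` is not claimed; no
debt is created.  When the §§2–4 files land, an edition can instantiate the dictionary fields by their definitions.

## Index (print item ↦ declaration)

| print | declaration | kind |
|---|---|---|
| §5 p. 38: `𝒞(G)`, tempered dual, `Φ¹`, `𝒜(T_γ)`-orbits, `𝔷`-finite, `F_Θ`; §3 p. 18 `χ_φ`; p. 19 `2q_G` | `TemperedSetting` | structure (data only) |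
| §5 p. 38 «invariant» ∕ «stable» tempered distribution | `IsInvariantDist`, `IsStableDist` | def |
| §5 p. 38 remark «A stable tempered distribution is invariant» | `Shelstad1979_5_stableIsInvariant` | def (Prop) |
| §5 LEMMA 5.1 (p. 38) | `Shelstad1979_5_1_stableIffOrbitConstant` | def (Prop) |
| §3 p. 18 ∕ §5 p. 39 «`χ_φ` … a tempered invariant eigendistribution»; «`χ_φ` denotes also the function on `G_reg` representing `χ_φ`» (p. 39) | `Shelstad1979_3_chiTemperedInvariantEigen`, `temperedCharFun` | def |
| §5 LEMMA 5.2 (p. 39) | `Shelstad1979_5_2_chiStable` | def (Prop) |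
| §5 LEMMA 5.3 (p. 40) | `Shelstad1979_5_3_stableOrbitalVanishingIffCharacters` | def (Prop) |
| §6 p. 41 (with §2 p. 16, §3 p. 17, §6 p. 41): the pair `G, G′`, «originates», `φ ↦ φ′`, `λ′ ↦ λ` | `InnerFormSetting` | structure (data only) |
| §4 THEOREM 4.1's relation `(f, f′)` (p. 21) and its sign `(−1)^{q_G − q_{G′}}` | `transferSign`, `IsTransferPair` | def |
| §6 p. 41 «`Θ : f ↦ Θ′(f′)`» | `IsDualImage` | def |
| §6 PROPOSITION 6.1 (p. 41) | `Shelstad1979_6_1_dualImageStable` | def (Prop) |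
| §6 LEMMA 6.2 (p. 41) | `Shelstad1979_6_2_dualImageEigen` | def (Prop) |
| §6 THEOREM 6.3 (p. 42) = the character identity announced on p. 19 | `Shelstad1979_6_3_characterIdentity` | def (Prop) |
| §5 p. 40 ∕ §6 p. 43: `M₀`, `𝔚`, `ζ`, `q_{M₀}` on both sides | `LeviDescentDatum`, `leviTransporter(')`, `frakW(')` | structure ∕ def |
| §6 PROPOSITION 6.4 (p. 43) | `Shelstad1979_6_4_doubleCosetBijection` | def (Prop) |
| §6 PROPOSITION 6.5 (p. 44) | `Shelstad1979_6_5_zetaMatch` | def (Prop) |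
| §6 PROPOSITION 6.6 (p. 44) | `Shelstad1979_6_6_qDifference` | def (Prop) |
| §6 COROLLARY 6.7 (p. 44) | `Shelstad1979_6_7_characterDuality` | def (Prop) |

Deliberately NOT typed here: Theorem 4.1 ∕ Theorem 4.7 themselves and the definition of `Φ¹_f` by Haar measures (§4, the companion
file `StableOrbitalIntegrals`); `𝒜(T)`, `𝒟(T)`, Theorem 2.1, the embeddings `ψ_x` and the parameter space `Φ(G)` (§§2–3, the companion file
`InnerFormsAndCharacters`); the proofs
(pp. 38–44: Weyl integration formula, Harish-Chandra's estimate `|F_Θ(x)| ≤ C|D(x)|^{−1/2}(1 + σ(x))^r`, the characterisation of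
`Θ*_λ` [4], the principal-series character formula `χ_φ(γ) = Σ_{s ∈ 𝔚} ζ(γ^s) χ_{φ₀}(γ^s)` [23]).  Dedup: the 99 existing
`[cite: Shelstad1979, …]` tags in the tree cite §4 ∕ Thm. 4.1 ∕ Thm. 4.7 as PROVENANCE inside ★ `Rogawski1990.ArchInnerTransferCompatible`
and its relatives, plus «Lemma 5.3», «Thm. 6.3, Cor. 6.7» named in the in-house-road paragraph of the same docstring — no statement
of §5 or §6 is in the tree (`lean search 'Schwartz|Tempered|eigendistribution|StablyConj|originates' --decl`: Mathlib's `SchwartzMap`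
on vector spaces, ★ `IsArchCasimirEigendistribution` for `GL_n`, ★ `Rogawski1990.IsStablyConj` for unitary matrices — no real-group
carrier).

## References
* [Shelstad1979] D. Shelstad, *Characters and inner forms of a quasi-split group over ℝ*, Compositio Math. 39 (1979) 11–45:
  §2 pp. 12–16, §3 pp. 16–20, §4 pp. 20–21, §5 pp. 38–41, §6 pp. 41–44 (NUMDAM `CM_1979__39_1_11_0`, held as `paper:url-551fef475f69`).
-/

universe u

namespace Literature.NumberTheory.Automorphic.Shelstad1979.Correspondences

/-! ## §5 — one group: the dictionary `TemperedSetting G` -/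

/-- **The Harish-Chandra data of ONE real group `G` used in §5** (data only; no field asserts a proposition).  `G` stands for the
group of real points (p. 12 «`G = 𝐆(ℝ)` is a reductive Lie group satisfying the conditions of [6]»).  Fields: `reg` = `G_reg`, the
regular set (p. 16); `schwartz` = `𝒞(G)`, «the space of Schwartz functions on `G`» as a `ℂ`-subspace of `G → ℂ` (p. 38); `tempered` =
«the space of tempered distributions on `G` … the dual of `𝒞(G)`» (p. 38), as the subspace of the algebraic dual consisting of the
continuous functionals; `stOrb γ` = the distribution `f ↦ Φ¹_f(γ)` (p. 38; `Φ¹_f(γ, dt, dg) = Σ_{ω ∈ 𝒟(T)} Φ_f(γ^ω, (dt)^ω, dg)`, p. 20,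
with the Haar measures fixed as on p. 20 — values at `γ ∉ G_reg` are never used); `stConj γ γ₁` = «`γ₁ = γ^ω` for some `ω ∈ 𝒜(T_γ)`»
(`𝒜(𝐓) = {g ∈ 𝐆 : ad g|𝐓 is defined over ℝ}`, p. 13; `T_γ` the Cartan subgroup containing `γ ∈ G_reg`, p. 16); `IsZFinite Θ` = «`Θ` …
finite under the action of `𝔷`, the center of the universal enveloping algebra of `𝔊`» (p. 38); `InfChar` = the characters of `𝔷`,
`IsEigen Θ λ` = «`Θ` is an eigendistribution with infinitesimal character `λ`» (p. 41); `F Θ` = «`F_Θ` … the analytic function on `G_reg`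
which represents `Θ` (cf. [6])» for `Θ` invariant and `𝔷`-finite (p. 38; junk otherwise); `Param` = the TEMPERED parameters `φ ∈ Φ(G)`
(p. 17) and `chi φ` = `χ_φ`, the character of `π_φ`, «a tempered invariant eigendistribution» (p. 18), as a functional on `𝒞(G)`;
`twoq` = `2q_G`, «the dimension of the symmetric space attached to the simply-connected covering of the derived group of `G`» (p. 19).
[cite: Shelstad1979, §5 p. 38; §2 pp. 13, 16; §3 pp. 17–19; §4 p. 20] -/
structure TemperedSetting (G : Type u) [Group G] where
  /-- `G_reg` (p. 16). -/
  reg : Set G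
  /-- `𝒞(G)`, the Schwartz space (p. 38). -/
  schwartz : Submodule ℂ (G → ℂ)
  /-- The tempered distributions: the (continuous) dual of `𝒞(G)` inside the algebraic dual (p. 38). -/
  tempered : Submodule ℂ (Module.Dual ℂ schwartz)
  /-- `γ ↦ (f ↦ Φ¹_f(γ))`, the stable orbital integrals (p. 20, p. 38). -/
  stOrb : G → Module.Dual ℂ schwartz
  /-- `stConj γ γ₁`: `γ₁ = γ^ω` for some `ω ∈ 𝒜(T_γ)` (pp. 13, 16, 38). -/
  stConj : G → G → Prop
  /-- «finite under the action of `𝔷`» (p. 38). -/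
  IsZFinite : Module.Dual ℂ schwartz → Prop
  /-- The characters `λ` of `𝔷` (infinitesimal characters, p. 41). -/
  InfChar : Type u
  /-- «eigendistribution with infinitesimal character `λ`» (p. 41). -/
  IsEigen : Module.Dual ℂ schwartz → InfChar → Prop
  /-- `F_Θ`, the analytic function on `G_reg` representing an invariant `𝔷`-finite `Θ` (p. 38, [6]). -/
  F : Module.Dual ℂ schwartz → G → ℂ
  /-- The tempered parameters `φ` (p. 17). -/
  Param : Type u
  /-- `χ_φ`, the character of `π_φ` (p. 18), a tempered distribution. -/
  chi : Param → Module.Dual ℂ schwartz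
  /-- `2q_G` (p. 19). -/
  twoq : ℕ

namespace TemperedSetting

variable {G : Type u} [Group G] (S : TemperedSetting G)

/-- **Invariant distribution**: `Θ(f^g) = Θ(f)` for every `g ∈ G` and every `f ∈ 𝒞(G)` whose conjugate `f^g : x ↦ f(g x g⁻¹)` lies in
`𝒞(G)` (in print `𝒞(G)` is conjugation-stable, so this is plain invariance; p. 38 «invariant tempered distribution», p. 39 the functions
`f^{(ω)}`). [cite: Shelstad1979, §5 pp. 38–39] -/
def IsInvariantDist (Θ : Module.Dual ℂ S.schwartz) : Prop :=
  ∀ (g : G) (f : S.schwartz) (hf : (fun x => (f : G → ℂ) (g * x * g⁻¹)) ∈ S.schwartz),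
    Θ ⟨fun x => (f : G → ℂ) (g * x * g⁻¹), hf⟩ = Θ f

/-- **Stable tempered distribution** (p. 38): «we regard the space of tempered distributions on `G` as the dual of `𝒞(G)`, equipped
with the topology of simple (pointwise) convergence. We call a tempered distribution *stable* if it lies in the closed linear subspace
generated by the distributions `f ↦ Φ¹_f(γ)`, `γ ∈ G_reg`».  TYPED: `Θ` is tempered and `Θ`, as a function `𝒞(G) → ℂ`, lies in the
closure — for Mathlib's product (= pointwise-convergence) topology on `𝒞(G) → ℂ` — of the `ℂ`-span of `{f ↦ Φ¹_f(γ) : γ ∈ G_reg}`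
(the closure taken inside the tempered dual equals this closure intersected with the tempered dual). [cite: Shelstad1979, §5 p. 38] -/
def IsStableDist (Θ : Module.Dual ℂ S.schwartz) : Prop :=
  Θ ∈ S.tempered ∧
    (⇑Θ : S.schwartz → ℂ) ∈
      closure ((fun Λ : Module.Dual ℂ S.schwartz => (⇑Λ : S.schwartz → ℂ)) ''
        (Submodule.span ℂ (S.stOrb '' S.reg) : Set (Module.Dual ℂ S.schwartz)))

/-- **Remark (p. 38)**: «A stable tempered distribution is invariant.» [cite: Shelstad1979, §5 p. 38] -/
def Shelstad1979_5_stableIsInvariant : Prop :=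
  ∀ Θ : Module.Dual ℂ S.schwartz, S.IsStableDist Θ → S.IsInvariantDist Θ

/-- **LEMMA 5.1 (p. 38).**  «Suppose that `Θ` is an invariant tempered distribution which is finite under the action of `𝔷` … Let `F_Θ`
denote the analytic function on `G_reg` which represents `Θ` (cf. [6]). Then: `Θ` is stable if and only if `F_Θ(γ) = F_Θ(γ^ω)`,
`γ ∈ G_reg`, `ω ∈ 𝒜(T_γ)`.» [cite: Shelstad1979, Lemma 5.1 (p. 38)] -/
def Shelstad1979_5_1_stableIffOrbitConstant : Prop :=
  ∀ Θ ∈ S.tempered, S.IsInvariantDist Θ → S.IsZFinite Θ →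
    (S.IsStableDist Θ ↔ ∀ γ ∈ S.reg, ∀ γω : G, S.stConj γ γω → S.F Θ γ = S.F Θ γω)

/-- **The standing facts about `χ_φ` (§3 p. 18, §5 p. 39)**: «In section 3 we attached to each tempered parameter `φ` a tempered
invariant eigendistribution `χ_φ`» — `χ_φ` is tempered, invariant, and an eigendistribution of `𝔷` (for some infinitesimal
character).  A context predicate on the dictionary, not a numbered item. [cite: Shelstad1979, §3 p. 18; §5 p. 39] -/
def Shelstad1979_3_chiTemperedInvariantEigen : Prop :=
  ∀ φ : S.Param, S.chi φ ∈ S.tempered ∧ S.IsInvariantDist (S.chi φ) ∧ ∃ lam : S.InfChar, S.IsEigen (S.chi φ) lam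

/-- **`χ_φ` as a function on `G_reg`** (p. 39 «We will use `χ_φ` to denote also the function on `G_reg` representing `χ_φ`»; p. 42
«As usual, `χ_φ` will also denote the function on `G_reg` which represents `χ_φ`»): `F_{χ_φ}`. [cite: Shelstad1979, §5 p. 39; §6 p. 42] -/
def temperedCharFun (φ : S.Param) : G → ℂ :=
  S.F (S.chi φ)

/-- **LEMMA 5.2 (p. 39).**  «`χ_φ` is stable» (`φ` a tempered parameter). [cite: Shelstad1979, Lemma 5.2 (p. 39)] -/
def Shelstad1979_5_2_chiStable : Prop :=
  ∀ φ : S.Param, S.IsStableDist (S.chi φ)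

/-- **LEMMA 5.3 (p. 40).**  «Let `f ∈ 𝒞(G)`. Then all stable orbital integrals for `f` vanish if and only if all `χ_φ(f)` vanish, `φ` a
tempered parameter.» [cite: Shelstad1979, Lemma 5.3 (p. 40)] -/
def Shelstad1979_5_3_stableOrbitalVanishingIffCharacters : Prop :=
  ∀ f : S.schwartz, (∀ γ ∈ S.reg, S.stOrb γ f = 0) ↔ ∀ φ : S.Param, S.chi φ f = 0

end TemperedSetting

/-! ## §6 — the pair `(G, G′)`: the dictionary `InnerFormSetting G G′` -/

/-- **The data of §6 for the pair `(G, G′)`** (data only): `G` an inner form of the quasi-split group `G′`, `ψ : 𝐆 → 𝐆′` fixed with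
`ψ̄ψ⁻¹` inner (pp. 13, 41).  Fields: the §5 dictionaries `S` of `G` and `S'` of `G′`; `originates γ′ γ` = «`γ′ ∈ G′` originates from `γ` in
`G_reg`»: «there exists `x ∈ 𝐆′` such that `ψ_x(γ) = γ′` and `ψ_x : 𝐓_γ → 𝐓_{γ′}` is defined over `ℝ`» (`ψ_x = ad x ∘ ψ`, p. 16; print
notes that `γ′` then originates exactly from the `γ^w`, `w ∈ 𝒜(T_γ)`, and that exactly the `(γ′)^{w′}`, `w′ ∈ 𝒜(T_{γ′})`, originate from
`γ`); `paramMap` = `φ ↦ φ′`, the embedding `Φ(G) ↪ Φ(G′)` induced by `ψ` on tempered parameters («`φ′` is tempered if and only if `φ` is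
tempered», p. 17); `infCharMap` = `λ′ ↦ λ`, the isomorphism «between characters on `𝔷′` and characters on `𝔷`» dual to `z ↦ z′` (p. 41).
[cite: Shelstad1979, §2 pp. 13, 16; §3 p. 17; §6 p. 41] -/
structure InnerFormSetting (G G' : Type u) [Group G] [Group G'] where
  /-- The §5 data of `G`. -/
  S : TemperedSetting G
  /-- The §5 data of `G′`. -/
  S' : TemperedSetting G'
  /-- «`γ′` originates from `γ`» (p. 16). -/
  originates : G' → G → Prop
  /-- `φ ↦ φ′` on tempered parameters (p. 17). -/
  paramMap : S.Param → S'.Param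
  /-- `λ′ ↦ λ` on infinitesimal characters (p. 41). -/
  infCharMap : S'.InfChar → S.InfChar

namespace InnerFormSetting

variable {G G' : Type u} [Group G] [Group G'] (D : InnerFormSetting G G')

/-- **The sign `(−1)^{q_G − q_{G′}}` of THEOREM 4.1** (p. 21: «The constant `(−1)^{q_G − q_{G′}}` is inserted to obtain the identity of
Corollary 6.7»), from `2q_G`, `2q_{G′}`: «`q_{G′} − q_G` is an integer» (p. 20), so the exponent `(2q_G − 2q_{G′})/2` is an exact
integer quotient in every model of print (for data with `2q_G − 2q_{G′}` odd the value is Lean's rounded quotient — junk, never print's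
case); it is the §4 companion file's sign evaluated at `q = (2q_G − 2q_{G′})/2`. [cite: Shelstad1979, Thm. 4.1 (p. 21); §3 pp. 19–20] -/
noncomputable def transferSign : ℂ :=
  (-1 : ℂ) ^ (((D.S.twoq : ℤ) - (D.S'.twoq : ℤ)) / 2)

/-- **The correspondence `(f, f′)` of THEOREM 4.1 (p. 21)** between `𝒞(G)` and `𝒞(G′)`: «for `γ′ ∈ G′_reg`,
`Φ¹_{f′}(γ′, dt′, dg′) = (−1)^{q_G − q_{G′}} Φ¹_f(γ, dt, dg)` if `γ′` originates from `γ` in `G`, `= 0` if `γ′` does not originate in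
`G`» (measures as on p. 20; «originates» is a relation on regular elements, p. 16, so `γ` ranges over `G`).  Theorem 4.1 itself —
that every `f` has such an `f′` — is the §4 companion file's statement (same two-case relation, sign `(−1)^q` as a function of the
integer `q = q_G − q_{G′}`) and is NOT asserted here; §6 p. 41: «Although `f′` is not uniquely determined, …». [cite: Shelstad1979, Thm. 4.1 (p. 21); §6 p. 41] -/
def IsTransferPair (f : D.S.schwartz) (f' : D.S'.schwartz) : Prop :=
  ∀ γ' ∈ D.S'.reg,
    (∀ γ : G, D.originates γ' γ → D.S'.stOrb γ' f' = D.transferSign * D.S.stOrb γ f) ∧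
    ((∀ γ : G, ¬ D.originates γ' γ) → D.S'.stOrb γ' f' = 0)

/-- **«`Θ : f ↦ Θ′(f′)`»** (p. 41: «there is a well-defined map, dual to the correspondence `(f, f′)`, defined on stable tempered
distributions»; proof of 6.2: «`zΘ` is the image of `z′Θ′` under our map»): `Θ` IS THE IMAGE of `Θ′` when `Θ(f) = Θ′(f′)` for every pair
`(f, f′)` in the correspondence. [cite: Shelstad1979, §6 p. 41] -/
def IsDualImage (Θ' : Module.Dual ℂ D.S'.schwartz) (Θ : Module.Dual ℂ D.S.schwartz) : Prop :=
  ∀ (f : D.S.schwartz) (f' : D.S'.schwartz), D.IsTransferPair f f' → Θ f = Θ' f'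

/-- **PROPOSITION 6.1 (p. 41).**  «If `Θ′` is a stable tempered distribution on `G′` then `Θ : f ↦ Θ′(f′)` defines a stable tempered
distribution on `G`.»  (Proof, p. 41: «Note that `Θ` is well-defined. A version of the Banach–Steinhaus theorem [16] implies that `Θ` is
continuous. Clearly then `Θ` is a stable tempered distribution on `G`.»)  TYPED as its three printed contents: `Θ′(f′)` does not depend
on the choice of `f′` corresponding to `f`, and there is a stable tempered distribution `Θ` on `G` which is the image of `Θ′`.
[cite: Shelstad1979, Prop. 6.1 (p. 41)] -/
def Shelstad1979_6_1_dualImageStable : Prop :=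
  ∀ Θ' : Module.Dual ℂ D.S'.schwartz, D.S'.IsStableDist Θ' →
    (∀ (f : D.S.schwartz) (f'₁ f'₂ : D.S'.schwartz),
        D.IsTransferPair f f'₁ → D.IsTransferPair f f'₂ → Θ' f'₁ = Θ' f'₂) ∧
      ∃ Θ : Module.Dual ℂ D.S.schwartz, D.S.IsStableDist Θ ∧ D.IsDualImage Θ' Θ

/-- **LEMMA 6.2 (p. 41).**  (Context p. 41: `Θ′` a stable tempered distribution on `G′`, `Θ` its image under the map of Proposition 6.1;
«Recall also the correspondence `(γ, γ′)` between `G_reg` and `G′_reg`».)  «If `Θ′` is an eigendistribution with infinitesimal character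
`λ′` then `Θ` is an eigendistribution with infinitesimal character `λ`. Moreover, `F_Θ(γ) = F_{Θ′}(γ′)`, `γ ∈ G_reg`.»
[cite: Shelstad1979, Lemma 6.2 (p. 41)] -/
def Shelstad1979_6_2_dualImageEigen : Prop :=
  ∀ (Θ' : Module.Dual ℂ D.S'.schwartz) (Θ : Module.Dual ℂ D.S.schwartz) (lam' : D.S'.InfChar),
    D.S'.IsStableDist Θ' → D.S'.IsEigen Θ' lam' → D.S.IsStableDist Θ → D.IsDualImage Θ' Θ →
      D.S.IsEigen Θ (D.infCharMap lam') ∧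
        ∀ γ ∈ D.S.reg, ∀ γ' ∈ D.S'.reg, D.originates γ' γ → D.S.F Θ γ = D.S'.F Θ' γ'

/-- **THEOREM 6.3 (p. 42)** — the character identity announced at the end of §3 (p. 19).  «If `φ` is a tempered parameter and
`γ′ ∈ G′_reg` originates from `γ ∈ G_reg` then `χ_{φ′}(γ′) = (−1)^{q_{G′} − q_G} χ_φ(γ)`» (`χ_φ`, `χ_{φ′}` as functions on `G_reg`,
`G′_reg`, p. 42; exponent `(2q_{G′} − 2q_G)/2 ∈ ℤ`, p. 20, cf. `transferSign`). [cite: Shelstad1979, Thm. 6.3 (p. 42); §3 p. 19] -/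
def Shelstad1979_6_3_characterIdentity : Prop :=
  ∀ (φ : D.S.Param), ∀ γ ∈ D.S.reg, ∀ γ' ∈ D.S'.reg, D.originates γ' γ →
    D.S'.temperedCharFun (D.paramMap φ) γ' =
      (-1 : ℂ) ^ (((D.S'.twoq : ℤ) - (D.S.twoq : ℤ)) / 2) * D.S.temperedCharFun φ γ

/-- **COROLLARY 6.7 (p. 44).**  «In proving Theorem 6.3 we have obtained the following result.  The map `χ_{φ′} ↦ χ_φ` is dual to the
correspondence `(f, f′)` between `𝒞(G)` and `𝒞(G′)`; that is, `χ_φ(f) = χ_{φ′}(f′)`.» [cite: Shelstad1979, Cor. 6.7 (p. 44)] -/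
def Shelstad1979_6_7_characterDuality : Prop :=
  ∀ (φ : D.S.Param) (f : D.S.schwartz) (f' : D.S'.schwartz),
    D.IsTransferPair f f' → D.S.chi φ f = D.S'.chi (D.paramMap φ) f'

end InnerFormSetting

/-! ## §6, proof of Theorem 6.3 — the three observations PROPOSITIONS 6.4–6.6: the dictionary `LeviDescentDatum D` -/

/-- **The Levi-descent data of the last step of the proof of THEOREM 6.3 (pp. 39–40, 43)** (data only).  To a tempered `φ` print
attaches `T₀`, `M₀`, `P₀ = M₀N₀` with `χ_φ = χ(Ind(π_φ ⊗ 1_{N₀}, P₀, G))` and, assuming `ψ|𝐓₀` defined over `ℝ`, `T₀′ = ψ(T₀)`, `M₀′ = ψ(M₀)`,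
`P₀′ = ψ(P₀)` attached to `φ′` (pp. 39, 43); a Cartan subgroup `T ⊆ M₀` of `G` and `x ∈ 𝐆′` with `ψ_x : 𝐓 → 𝐓′` defined over `ℝ`, `x ∈ 𝐌₀′`, so
`T′ ⊆ M₀′` (p. 43).  Fields: `M₀`, `M₀'`, `T`; `psiX` = `ψ_x` on `T` (a homomorphism `T → G′`, its range is `T′`); `AdmViaLevi U e` = «`e`
agrees on the Cartan subgroup `U` with `ψ_{x₀}` for some `x₀ ∈ 𝐌₀′` with `ψ_{x₀} : 𝐔 → ψ_{x₀}(𝐔)` defined over `ℝ`» (p. 43, proof of 6.4: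
«there exists … `x₀ ∈ 𝐌₀′` with `ψ_{x₀} : 𝐓^s → (𝐓^s)′ = ψ_{x₀}(𝐓^s)` defined over `ℝ`»); `zeta` = `ζ(γ) = |det(Ad γ − 1)_{𝔤/𝔪₀}|`, `γ ∈ M₀`,
and `zeta'` = `ζ′` «defined relative to `G′` and `M₀′`» (pp. 40, 43); `twoqM`, `twoqM'` = `2q_{M₀}`, `2q_{M₀′}` (p. 44).
[cite: Shelstad1979, §5 pp. 39–40; §6 pp. 43–44] -/
structure LeviDescentDatum {G G' : Type u} [Group G] [Group G'] (D : InnerFormSetting G G') where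
  /-- `M₀ ⊆ G` (p. 39). -/
  M₀ : Subgroup G
  /-- `M₀′ = ψ(M₀) ⊆ G′` (p. 43). -/
  M₀' : Subgroup G'
  /-- The Cartan subgroup `T ⊆ M₀` (pp. 40, 43). -/
  T : Subgroup G
  /-- `ψ_x` on `T`, `ψ_x : T → T′` defined over `ℝ` (p. 43). -/
  psiX : T →* G'
  /-- «`e = ψ_{x₀}` on `U` for some `x₀ ∈ 𝐌₀′` with `ψ_{x₀} : 𝐔 → ψ_{x₀}(𝐔)` defined over `ℝ`» (p. 43). -/
  AdmViaLevi : Subgroup G → (G → G') → Prop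
  /-- `ζ(γ) = |det(Ad γ − 1)_{𝔤/𝔪₀}|`, `γ ∈ M₀` (p. 40). -/
  zeta : G → ℝ
  /-- `ζ′`, relative to `G′`, `M₀′` (p. 43). -/
  zeta' : G' → ℝ
  /-- `2q_{M₀}` (p. 44). -/
  twoqM : ℕ
  /-- `2q_{M₀′}` (p. 44). -/
  twoqM' : ℕ

namespace LeviDescentDatum

variable {G G' : Type u} [Group G] [Group G'] {D : InnerFormSetting G G'} (L : LeviDescentDatum D)

/-- `{x ∈ G : x T x⁻¹ ⊆ M₀}` (p. 40). [cite: Shelstad1979, §5 p. 40] -/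
def leviTransporter : Set G :=
  {x : G | ∀ t ∈ L.T, x * t * x⁻¹ ∈ L.M₀}

/-- `{x ∈ G′ : x T′ x⁻¹ ⊆ M₀′}`, `T′ = ψ_x(T)` (p. 43). [cite: Shelstad1979, §6 p. 43] -/
def leviTransporter' : Set G' :=
  {x : G' | ∀ t ∈ L.psiX.range, x * t * x⁻¹ ∈ L.M₀'}

/-- **`𝔚 = M₀\{x ∈ G : xTx⁻¹ ⊆ M₀}`** (p. 40), as the set of right cosets `M₀ x`, `x` in the transporter, inside Mathlib's right-coset
space `Quotient (QuotientGroup.rightRel M₀)`. [cite: Shelstad1979, §5 p. 40] -/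
def frakW : Set (Quotient (QuotientGroup.rightRel L.M₀)) :=
  {w | ∃ x ∈ L.leviTransporter, Quotient.mk (QuotientGroup.rightRel L.M₀) x = w}

/-- **`𝔚′`**, «defined relative to `G′` and `M₀′`» (p. 43). [cite: Shelstad1979, §6 p. 43] -/
def frakW' : Set (Quotient (QuotientGroup.rightRel L.M₀')) :=
  {w | ∃ x ∈ L.leviTransporter', Quotient.mk (QuotientGroup.rightRel L.M₀') x = w}

/-- **PROPOSITION 6.4 (p. 43).**  «There is bijection between `𝔚` and `𝔚′` with the following property: if `s` represents a class in `𝔚`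
then there exists `s′` representing the image of this class in `𝔚′` and such that `(γ^s)′ = (γ′)^{s′}` for all `γ ∈ T`.»  With print's
gloss (proof, p. 43): «By this equation we mean precisely: if `s ∈ {x ∈ G : xTx⁻¹ ⊆ M₀}` then there exists `s′ ∈ {x ∈ G′ : xT′x⁻¹ ⊆ M₀′}`
and `x₀ ∈ 𝐌₀′` with `ψ_{x₀} : 𝐓^s → (𝐓^s)′ = ψ_{x₀}(𝐓^s)` defined over `ℝ` and such that `ψ_{x₀}(γ^s) = (ψ_x(γ))^{s′}`» (`γ^s = sγs⁻¹`,
`𝐓^s = s𝐓s⁻¹`). [cite: Shelstad1979, Prop. 6.4 (p. 43)] -/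
def Shelstad1979_6_4_doubleCosetBijection : Prop :=
  ∃ β : L.frakW ≃ L.frakW',
    ∀ (s : G) (hs : s ∈ L.leviTransporter), ∃ s' ∈ L.leviTransporter',
      ((β ⟨Quotient.mk (QuotientGroup.rightRel L.M₀) s, s, hs, rfl⟩ : L.frakW') :
          Quotient (QuotientGroup.rightRel L.M₀')) = Quotient.mk (QuotientGroup.rightRel L.M₀') s' ∧
        ∃ e : G → G', L.AdmViaLevi (L.T.map (MulAut.conj s).toMonoidHom) e ∧
          ∀ γ : L.T, e (s * (γ : G) * s⁻¹) = s' * L.psiX γ * s'⁻¹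

/-- **PROPOSITION 6.5 (p. 44).**  «`ζ(γ^s) = ζ′(γ′^{s′})`» («This follows immediately from our definitions»), for `s ↔ s′` as in Proposition
6.4: whenever `s`, `s′` lie in the transporters and `ψ_{x₀}` (`x₀ ∈ 𝐌₀′`, defined over `ℝ` on `𝐓^s`) carries `γ^s` to `(γ′)^{s′}` on `T`,
the identity holds at every `γ ∈ T`. [cite: Shelstad1979, Prop. 6.5 (p. 44)] -/
def Shelstad1979_6_5_zetaMatch : Prop :=
  ∀ s ∈ L.leviTransporter, ∀ s' ∈ L.leviTransporter', ∀ e : G → G',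
    L.AdmViaLevi (L.T.map (MulAut.conj s).toMonoidHom) e →
      (∀ γ : L.T, e (s * (γ : G) * s⁻¹) = s' * L.psiX γ * s'⁻¹) →
        ∀ γ : L.T, L.zeta (s * (γ : G) * s⁻¹) = L.zeta' (s' * L.psiX γ * s'⁻¹)

/-- **PROPOSITION 6.6 (p. 44).**  «`q_{M₀} − q_G = q_{M₀′} − q_{G′}`», stated on the doubled quantities `2q` (p. 19): `2q_{M₀} − 2q_G =
2q_{M₀′} − 2q_{G′}` in `ℤ`. [cite: Shelstad1979, Prop. 6.6 (p. 44)] -/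
def Shelstad1979_6_6_qDifference : Prop :=
  (L.twoqM : ℤ) - (D.S.twoq : ℤ) = (L.twoqM' : ℤ) - (D.S'.twoq : ℤ)

end LeviDescentDatum

end Literature.NumberTheory.Automorphic.Shelstad1979.Correspondences
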